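import Summits.NavierStokesRegularity.NavierStokesRegularity.Theorems.SqueezeCycleExtremalElementExistsRegularity
import Literature.Analysis.FluidPDE.TypeIRateOseenMildRepresentative
import Literature.Analysis.FluidPDE.TypeIAncientMildClassical
import Literature.Analysis.FluidPDE.NSLocalLerayBackwardUniquenessUC
import Literature.Analysis.FluidPDE.CurlFreeLiouville
import Literature.Analysis.FluidPDE.LocalTypeILiouville
import HarnessLib

/-!
# Crux `RecurrentLiouville` (stmt-NavierStokesRegularity-1589), line `Sketch` — stub
# `stub_satDarkProfilesTrivial`: dark profiles are trivial

Theorems-only file (no definitions, no named facts).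

`stub_satDarkProfilesTrivial` (D3) — DARK PROFILES ARE TRIVIAL (assembly; Escauriaza–Seregin–Šverák
2003, end of §3 with Thm. 4.1 and §5).  Let `(u, p)` be a suitable weak solution of the unforced
Navier–Stokes system (`ν = 1`) on the backward slab `(−∞, 0) × ℝ³` with a weak spatial gradient,
Albritton–Barker's `𝐈(ℝ³ × ℝ₋) < ∞` and the apex bound `‖u(t, x)‖ ≤ C/(‖x‖ + √(−t))`
(`HasTypeIDecay C u`), and suppose that its far field is irrotational on `(-1, 0) × {x₂ > R}`
through a continuous representative `U` with `C¹` slices (`U = u` a.e. there, `∇ ∧ U(t, ·) = 0` on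
`{x₂ > R}` for `t ∈ (-1, 0)`; the output of the landed stubs D1 + D2).  Then the origin is not a
backward singular point of `u`; indeed `u = 0` a.e. on `(-1, 0) × ℝ³`.

Route over the tree.
1. The apex bound gives the rate `C/√(−t)`, so the slab form of Albritton–Barker 2019, Thm 1.1
   (`exists_oseenMild_repr_of_typeIBound_lt_top`) supplies a continuous Oseen-mild representative
   `v = u` a.e. on the slab, a Type-I ancient mild field by KNSS 2009, Prop. 4.1
   (`isTypeIAncientMild_of_continuous_oseenMild`): jointly smooth, divergence free, and classical
   on `(-1, 0)` for some smooth pressure (`IsTypeIAncientMild.exists_isClassicalNSSolutionOn_Ioo`).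
2. `v` and `U` are continuous and a.e. equal on the open far region, hence equal there
   (`Measure.eqOn_open_of_ae_eq`); the curl only sees the germ, so `∇ ∧ v(t, ·) = 0` on
   `{x₂ > R} ⊇ B(x_c, 1)`, `x_c = (R + 2) e₂`, for `t ∈ (-1, 0)`.
3. Unique continuation through spatial boundaries for the vorticity of a classical solution
   (ESS 2003, Thm. 4.1, the tree's `IsClassicalNSSolutionOn.curl_eq_zero_of_eqOn_ball`, after the
   time shift `s = t + 1` to the window `(0, 1)`): `∇ ∧ v(t, ·) ≡ 0` on `ℝ³`, `t ∈ (-1, 0)`.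
4. A bounded (`‖v(t)‖ ≤ C/√(−t)`), divergence-free, irrotational `C²` field on `ℝ³` is constant
   (harmonic Liouville, KNSS 2009, Lemma 3.1; `eq_of_curl_eq_zero_of_isDivFree_of_bounded`), and
   the apex bound — which passes from `u` to the continuous `v` everywhere on the slab — forces
   the constant to vanish (`‖b‖ ≤ C/(‖x‖ + √(−t)) → 0` as `‖x‖ → ∞`).  So `v(t, ·) = 0` for
   `t ∈ (-1, 0)`, `u = 0` a.e. on `(-1, 0) × ℝ³ ⊇ Q(0, 1)`, and `‖u‖_{L^∞(Q(0,1))} = 0 ≠ ∞`.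

## References

* L. Escauriaza, G. Seregin, V. Šverák, Russian Math. Surveys 58 (2003) 211–250, Thm. 4.1 and
  §5. [cite: EscauriazaSereginSverak2003, Thm. 4.1 and §5]
* D. Albritton, T. Barker, J. Math. Fluid Mech. 21 (2019) = arXiv:1811.00502, Thm 1.1.
  [cite: AlbrittonBarker2019, Thm 1.1]
* G. Koch, N. Nadirashvili, G. Seregin, V. Šverák, Acta Math. 203 (2009) = arXiv:0709.3599,
  Prop. 4.1 and Lemma 3.1. [cite: KochNadirashviliSereginSverak2009, Prop. 4.1]
-/

noncomputable section

-- the sub-problem namespace repeats the summit name (D-0017 layout `Summit.<S>.<P>.Theorems`)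
set_option linter.dupNamespace false

namespace Summit.NavierStokesRegularity.NavierStokesRegularity.Theorems

open MeasureTheory Set Function Filter Topology TopologicalSpace Metric
open Literature.Analysis.FluidPDE
open scoped NNReal ENNReal RealInnerProductSpace Laplacian ContDiff

/-! ## Tools -/

/-- A field vanishing a.e. on the unit backward slab `(-1, 0) × ℝ³ ⊇ Q(0, 1)` is not singular at
the origin: `‖u‖_{L^∞(Q(0,1))} = 0 ≠ ∞`. [folklore] -/
-- adapted from `satCE_not_singular_of_ae_zero_ball` (`…RecurrentLiouvilleClosingEndpoints`)
private theorem satDP_not_singular_of_ae_zero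
    {u : ℝ → EuclideanSpace ℝ (Fin 3) → EuclideanSpace ℝ (Fin 3)}
    (h : ∀ᵐ z ∂(volume.restrict (Ioo (-1 : ℝ) 0 ×ˢ (univ : Set (EuclideanSpace ℝ (Fin 3))))),
      uncurry u z = (0 : ℝ × EuclideanSpace ℝ (Fin 3) → EuclideanSpace ℝ (Fin 3)) z) :
    ¬ IsBackwardSingularPoint u 0 := by
  intro hsing
  have hsub : parabolicCylinder 1 (0 : ℝ × EuclideanSpace ℝ (Fin 3)) ⊆
      Ioo (-1 : ℝ) 0 ×ˢ (univ : Set (EuclideanSpace ℝ (Fin 3))) := by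
    intro w hw
    rw [mem_parabolicCylinder] at hw
    obtain ⟨⟨h1, h2⟩, -⟩ := hw
    simp only [Prod.fst_zero] at h1 h2
    exact ⟨⟨by linarith, h2⟩, mem_univ _⟩
  have hQ : uncurry u =ᵐ[volume.restrict
      (parabolicCylinder 1 (0 : ℝ × EuclideanSpace ℝ (Fin 3)))] 0 :=
    ae_restrict_of_ae_restrict_of_subset hsub h
  have h0 : eLpNorm (uncurry u) ∞
      (volume.restrict (parabolicCylinder 1 (0 : ℝ × EuclideanSpace ℝ (Fin 3)))) = 0 := by
    rw [eLpNorm_congr_ae hQ, eLpNorm_zero]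
  have htop := hsing 1 one_pos
  rw [h0] at htop
  exact ENNReal.zero_ne_top htop

/-- The curl at a point only depends on the germ of the field: `f = g` near `x` gives
`curl f x = curl g x` (`curl` is built from `fderiv`; `Filter.EventuallyEq.fderiv_eq`).
[folklore] -/
private theorem satDP_curl_congr
    {f g : EuclideanSpace ℝ (Fin 3) → EuclideanSpace ℝ (Fin 3)} {x : EuclideanSpace ℝ (Fin 3)}
    (h : f =ᶠ[𝓝 x] g) : curl f x = curl g x := by
  simp only [curl, h.fderiv_eq]

/-- The unit ball about `x_c = (R + 2) e₂` lies in the half-space `{x₂ > R}`: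
`|y₂ − (R + 2)| ≤ ‖y − x_c‖ < 1`. [folklore] -/
private theorem satDP_ball_subset (R : ℝ) :
    ball (EuclideanSpace.single (2 : Fin 3) (R + 2) : EuclideanSpace ℝ (Fin 3)) 1 ⊆
      {x : EuclideanSpace ℝ (Fin 3) | R < x 2} := by
  intro y hy
  rw [mem_ball] at hy
  have h1 : dist (y 2)
      ((EuclideanSpace.single (2 : Fin 3) (R + 2) : EuclideanSpace ℝ (Fin 3)) 2) < 1 :=
    (PiLp.dist_apply_le y _ 2).trans_lt hy
  have h2 : (EuclideanSpace.single (2 : Fin 3) (R + 2) : EuclideanSpace ℝ (Fin 3)) 2 = R + 2 := by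
    simp
  rw [h2, Real.dist_eq] at h1
  rw [mem_setOf_eq]
  have := (abs_lt.1 h1).1
  linarith

/-- **The apex bound passes to a continuous representative.**  If `u = v` a.e. on the open slab,
`v` is continuous there and `‖u(t, x)‖ ≤ C/(‖x‖ + √(−t))` for all `t < 0`, `x`, then the same bound
holds for `v` everywhere on the slab: the continuous excess `max (‖v‖ − C/(‖x‖ + √(−t))) 0`
vanishes a.e. on the open slab, hence everywhere (`Measure.eqOn_open_of_ae_eq`). [folklore] -/
-- adapted from `satCE_decay_repr` (`…RecurrentLiouvilleClosingEndpoints`)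
private theorem satDP_decay_repr
    {u v : ℝ → EuclideanSpace ℝ (Fin 3) → EuclideanSpace ℝ (Fin 3)} {C : ℝ}
    (hae : ∀ᵐ z ∂(volume.restrict (Iio (0 : ℝ) ×ˢ (univ : Set (EuclideanSpace ℝ (Fin 3))))),
      uncurry u z = uncurry v z)
    (hcont : ContinuousOn (uncurry v) (Iio 0 ×ˢ univ)) (hdec : HasTypeIDecay C u)
    {t : ℝ} (ht : t < 0) (x : EuclideanSpace ℝ (Fin 3)) :
    ‖v t x‖ ≤ C / (‖x‖ + Real.sqrt (-t)) := by
  have hBc : ContinuousOn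
      (fun z : ℝ × EuclideanSpace ℝ (Fin 3) => C / (‖z.2‖ + Real.sqrt (-z.1)))
      (Iio (0 : ℝ) ×ˢ (univ : Set (EuclideanSpace ℝ (Fin 3)))) := by
    refine continuousOn_const.div
      (continuous_snd.norm.add continuous_fst.neg.sqrt).continuousOn fun z hz => ?_
    have hz1 : z.1 < 0 := hz.1
    exact (add_pos_of_nonneg_of_pos (norm_nonneg _) (Real.sqrt_pos.2 (neg_pos.2 hz1))).ne'
  have hfc : ContinuousOn
      (fun z : ℝ × EuclideanSpace ℝ (Fin 3) =>
        max (‖uncurry v z‖ - C / (‖z.2‖ + Real.sqrt (-z.1))) 0)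
      (Iio (0 : ℝ) ×ˢ (univ : Set (EuclideanSpace ℝ (Fin 3)))) :=
    (hcont.norm.sub hBc).sup continuousOn_const
  have hf0 : (fun z : ℝ × EuclideanSpace ℝ (Fin 3) =>
        max (‖uncurry v z‖ - C / (‖z.2‖ + Real.sqrt (-z.1))) 0) =ᵐ[
      volume.restrict (Iio (0 : ℝ) ×ˢ (univ : Set (EuclideanSpace ℝ (Fin 3))))]
      fun _ => (0 : ℝ) := by
    filter_upwards [hae, ae_restrict_mem (measurableSet_Iio.prod MeasurableSet.univ)]
      with z hz hzm
    have hle : ‖uncurry v z‖ ≤ C / (‖z.2‖ + Real.sqrt (-z.1)) := by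
      rw [← hz]
      exact hdec z.1 hzm.1 z.2
    exact max_eq_right (sub_nonpos.2 hle)
  have hEq := Measure.eqOn_open_of_ae_eq hf0 (isOpen_Iio.prod isOpen_univ) hfc continuousOn_const
  have h := hEq (x := (t, x)) ⟨ht, mem_univ _⟩
  simp only [uncurry_apply_pair] at h
  have h' := max_eq_right_iff.1 h
  linarith

/-- **A spatially constant field with the apex bound vanishes**: if `V x = V y` for all `x, y`
and `‖V x‖ ≤ C/(‖x‖ + a)` (`a > 0`, `C ≥ 0`) for all `x`, then `V = 0` — evaluate the bound at
`x₀ = r e₀`, `r = C/‖V x‖ + 1`. [folklore] -/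
private theorem satDP_eq_zero_of_const_of_decay
    {V : EuclideanSpace ℝ (Fin 3) → EuclideanSpace ℝ (Fin 3)} {C a : ℝ} (hC : 0 ≤ C) (ha : 0 < a)
    (hconst : ∀ x y, V x = V y) (hle : ∀ x, ‖V x‖ ≤ C / (‖x‖ + a))
    (x : EuclideanSpace ℝ (Fin 3)) : V x = 0 := by
  by_contra hb
  have hb0 : 0 < ‖V x‖ := norm_pos_iff.2 hb
  set r : ℝ := C / ‖V x‖ + 1 with hr
  have hr0 : 0 < r := by positivity
  have hx₀ : ‖(EuclideanSpace.single (0 : Fin 3) r : EuclideanSpace ℝ (Fin 3))‖ = r := by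
    rw [PiLp.norm_single, Real.norm_of_nonneg hr0.le]
  have key := hle (EuclideanSpace.single (0 : Fin 3) r)
  rw [← hconst x, hx₀] at key
  have key' : ‖V x‖ * (r + a) ≤ C := (le_div_iff₀ (by positivity)).1 key
  have e : ‖V x‖ * r = C + ‖V x‖ := by
    rw [hr, mul_add, mul_one, mul_div_cancel₀ _ hb0.ne']
  nlinarith [mul_pos hb0 ha]

/-- **Interior unique continuation of the vorticity on the window `(-1, 0)`** (ESS 2003,
Thm. 4.1, the tree's `IsClassicalNSSolutionOn.curl_eq_zero_of_eqOn_ball`): a Type-I ancient mild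
field is classical on `(-1, 0)` (`IsTypeIAncientMild.exists_isClassicalNSSolutionOn_Ioo`); after
the time shift `s = t + 1` it is classical on `(0, 1)`, so a vorticity vanishing on
`(-1, 0) × B(x_c, 1)` vanishes on `(-1, 0) × ℝ³` (for `t` use the sub-window `((t+1)/2, 1)`).
[cite: EscauriazaSereginSverak2003, Thm. 4.1 and §5] -/
private theorem satDP_curl_eq_zero_of_ball {C : ℝ}
    {v : ℝ → EuclideanSpace ℝ (Fin 3) → EuclideanSpace ℝ (Fin 3)} (hTI : IsTypeIAncientMild C v)
    {xc : EuclideanSpace ℝ (Fin 3)}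
    (hfar : ∀ t ∈ Ioo (-1 : ℝ) 0, ∀ x ∈ ball xc 1, curl (v t) x = 0) :
    ∀ t ∈ Ioo (-1 : ℝ) 0, ∀ x : EuclideanSpace ℝ (Fin 3), curl (v t) x = 0 := by
  obtain ⟨q, hcl⟩ := hTI.exists_isClassicalNSSolutionOn_Ioo (t₀ := -1) (by norm_num)
  have h1 := hcl.comp_add_right (-1)
  have hset : (fun t : ℝ => t + -1) ⁻¹' Ioo (-1) 0 = Ioo 0 1 := by
    ext t
    simp only [mem_preimage, mem_Ioo]
    constructor
    · rintro ⟨h1, h2⟩; exact ⟨by linarith, by linarith⟩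
    · rintro ⟨h1, h2⟩; exact ⟨by linarith, by linarith⟩
  rw [hset] at h1
  have hf : (fun t : ℝ =>
      (0 : ℝ → EuclideanSpace ℝ (Fin 3) → EuclideanSpace ℝ (Fin 3)) (t + -1)) = 0 := by
    funext t; rfl
  rw [hf] at h1
  intro t ht x
  have hδ : 0 < (t + 1) / 2 := by linarith [ht.1]
  have hzero : ∀ s ∈ Ioo ((t + 1) / 2) 1, ∀ y ∈ ball xc 1, curl (v (s + -1)) y = 0 :=
    fun s hs y hy => hfar (s + -1) ⟨by linarith [hs.1], by linarith [hs.2]⟩ y hy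
  have key : curl (v (t + 1 + -1)) x = 0 :=
    h1.curl_eq_zero_of_eqOn_ball one_pos hδ le_rfl one_pos hzero (t + 1)
      ⟨by linarith [ht.1], by linarith [ht.2]⟩ x
  have e : t + 1 + -1 = t := by ring
  rwa [e] at key

/-! ## D3 — dark profiles are trivial (ESS Thm. 4.1 + harmonic Liouville) -/

/-- **D3, dark profiles are trivial (assembly).**  A member of the class with the apex bound
whose far field is irrotational on `(-1, 0) × {x₂ > R}` (through a continuous representative
`U` with `C¹` slices: the output of D1 + D2) is regular at the origin: the continuous Oseen-mild
representative `v` (`exists_oseenMild_repr_of_typeIBound_lt_top`, `IsTypeIAncientMild`) is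
classical on `(-1, 0)` (`IsTypeIAncientMild.exists_isClassicalNSSolutionOn_Ioo`), agrees with `U`
on the far-field region, so its vorticity vanishes on an open set and hence on all of
`(-1, 0) × ℝ³` (`IsClassicalNSSolutionOn.curl_eq_zero_of_eqOn_ball`); a bounded divergence-free,
curl-free slice is constant (harmonic Liouville, `eq_of_curl_eq_zero_of_isDivFree_of_bounded`)
and decays (apex bound), so it vanishes; thus `u = 0` a.e. on `(-1, 0) × ℝ³ ⊇ Q(0,1)`.
[cite: EscauriazaSereginSverak2003, Thm. 4.1 and §5] [cite: AlbrittonBarker2019, Thm 1.1]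
[cite: KochNadirashviliSereginSverak2009, Prop. 4.1] -/
theorem stub_satDarkProfilesTrivial :
    ∀ (u : ℝ → EuclideanSpace ℝ (Fin 3) → EuclideanSpace ℝ (Fin 3))
      (p : ℝ → EuclideanSpace ℝ (Fin 3) → ℝ)
      (G : ℝ → EuclideanSpace ℝ (Fin 3) → EuclideanSpace ℝ (Fin 3) →L[ℝ] EuclideanSpace ℝ (Fin 3)) (C : ℝ),
      IsSuitableWeakSolutionOn (slab (EuclideanSpace ℝ (Fin 3)) (Iio 0) isOpen_Iio) 1 0 u p →
      HasWeakSpatialGradientOn (slab (EuclideanSpace ℝ (Fin 3)) (Iio 0) isOpen_Iio) u G →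
      typeIBound (Iio (0 : ℝ) ×ˢ univ) u p G < ⊤ → HasTypeIDecay C u →
      (∃ (R : ℝ) (U : ℝ → EuclideanSpace ℝ (Fin 3) → EuclideanSpace ℝ (Fin 3)),
        ContinuousOn (uncurry U) (Ioo (-1 : ℝ) 0 ×ˢ {x : EuclideanSpace ℝ (Fin 3) | R < x 2}) ∧
        uncurry U =ᵐ[volume.restrict
          (Ioo (-1 : ℝ) 0 ×ˢ {x : EuclideanSpace ℝ (Fin 3) | R < x 2})] uncurry u ∧
        (∀ t ∈ Ioo (-1 : ℝ) 0, ContDiffOn ℝ 1 (U t) {x : EuclideanSpace ℝ (Fin 3) | R < x 2}) ∧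
        ∀ t ∈ Ioo (-1 : ℝ) 0, ∀ x : EuclideanSpace ℝ (Fin 3), R < x 2 → curl (U t) x = 0) →
      ¬ IsBackwardSingularPoint u 0 := by
  intro u p G C hsw _hwg hI hdec hfar
  obtain ⟨R, U, hUc, hUae, -, hUcurl⟩ := hfar
  -- ## the apex bound gives the rate, with `0 ≤ C`
  have hC0 : 0 ≤ C := by
    have h := hdec (-1) (by norm_num) 0
    rw [norm_zero, zero_add, neg_neg, Real.sqrt_one, div_one] at h
    exact (norm_nonneg _).trans h
  -- ## continuous Oseen-mild representative, a Type-I ancient mild field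
  obtain ⟨v, hae, hcont, hdiv, hmild, hrate⟩ :=
    exists_oseenMild_repr_of_typeIBound_lt_top hsw (hdec.hasTypeITimeDecay hC0) hI
  have hTI : IsTypeIAncientMild C v :=
    isTypeIAncientMild_of_continuous_oseenMild hcont hdiv hmild hrate
  have hdecv : ∀ t < 0, ∀ x : EuclideanSpace ℝ (Fin 3), ‖v t x‖ ≤ C / (‖x‖ + Real.sqrt (-t)) :=
    fun t ht x => satDP_decay_repr hae hcont hdec ht x
  -- ## `v = U` on the open far region, so `curl v(t) = 0` there
  set S : Set (EuclideanSpace ℝ (Fin 3)) := {x : EuclideanSpace ℝ (Fin 3) | R < x 2} with hS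
  have hSo : IsOpen S := by
    have hc : Continuous fun x : EuclideanSpace ℝ (Fin 3) => x 2 := by fun_prop
    exact isOpen_lt continuous_const hc
  have hΩo : IsOpen (Ioo (-1 : ℝ) 0 ×ˢ S) := isOpen_Ioo.prod hSo
  have hΩsub : Ioo (-1 : ℝ) 0 ×ˢ S ⊆ Iio (0 : ℝ) ×ˢ (univ : Set (EuclideanSpace ℝ (Fin 3))) :=
    prod_mono Ioo_subset_Iio_self (subset_univ _)
  have hUv : uncurry U =ᵐ[volume.restrict (Ioo (-1 : ℝ) 0 ×ˢ S)] uncurry v :=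
    hUae.trans (ae_restrict_of_ae_restrict_of_subset hΩsub hae)
  have hEq : EqOn (uncurry U) (uncurry v) (Ioo (-1 : ℝ) 0 ×ˢ S) :=
    Measure.eqOn_open_of_ae_eq hUv hΩo hUc (hcont.mono hΩsub)
  have hcurlfar : ∀ t ∈ Ioo (-1 : ℝ) 0, ∀ x ∈ S, curl (v t) x = 0 := by
    intro t ht x hx
    have hev : U t =ᶠ[𝓝 x] v t := by
      filter_upwards [hSo.mem_nhds hx] with y hy
      exact hEq (mk_mem_prod ht hy)
    rw [← satDP_curl_congr hev]
    exact hUcurl t ht x hx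
  -- ## unique continuation: `curl v(t) = 0` on `ℝ³` for `t ∈ (-1, 0)`
  have hball : ∀ t ∈ Ioo (-1 : ℝ) 0,
      ∀ x ∈ ball (EuclideanSpace.single (2 : Fin 3) (R + 2) : EuclideanSpace ℝ (Fin 3)) 1,
      curl (v t) x = 0 :=
    fun t ht x hx => hcurlfar t ht x (satDP_ball_subset R hx)
  have hcurl0 := satDP_curl_eq_zero_of_ball hTI hball
  -- ## harmonic Liouville: bounded, divergence-free, curl-free slices are constant, then zero
  have hv0 : ∀ t ∈ Ioo (-1 : ℝ) 0, ∀ x : EuclideanSpace ℝ (Fin 3), v t x = 0 := by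
    intro t ht
    have ht0 : t < 0 := ht.2
    have h2 : ContDiff ℝ 2 (v t) := (hTI.contDiff_slice ht0).of_le (by norm_cast)
    have hconst : ∀ x y : EuclideanSpace ℝ (Fin 3), v t x = v t y :=
      eq_of_curl_eq_zero_of_isDivFree_of_bounded h2 (hcurl0 t ht) (hTI.isDivFree ht0)
        (fun x => hrate t ht0 x)
    exact satDP_eq_zero_of_const_of_decay hC0 (Real.sqrt_pos.2 (neg_pos.2 ht0)) hconst
      (hdecv t ht0)
  -- ## `u = 0` a.e. on `(-1, 0) × ℝ³ ⊇ Q(0, 1)`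
  refine satDP_not_singular_of_ae_zero ?_
  filter_upwards [ae_restrict_of_ae_restrict_of_subset (prod_mono Ioo_subset_Iio_self Subset.rfl)
    hae, ae_restrict_mem (measurableSet_Ioo.prod MeasurableSet.univ)] with z hz hzm
  rw [hz]
  exact hv0 z.1 hzm.1 z.2

end Summit.NavierStokesRegularity.NavierStokesRegularity.Theorems

end
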